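import Literature.Computability.Cryptography.Indistinguishability
import Literature.Computability.Cryptography.FiniteHybrids
import Literature.Computability.Complexity.HashBricks
import Literature.Computability.Complexity.StackUnary
import HarnessLib

/-!
# Yao's theorem (pseudorandomness versus unpredictability): the two reductions as machines

Machine layer for the discharge of
`Literature.Computability.Cryptography.isPseudorandom_iff_isNextBitUnpredictable`
(`Pseudorandomness.lean`; Yao 1982, Goldreich 2001 Thm. 3.3.7, Arora–Barak 2009 Thm. 9.11).
Both directions of the printed proof transform one probabilistic polynomial-time algorithm into
another; this file defines the two run functions and proves that they are polynomial time on the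
pair presentation of (input, coins), as pipelines of the tree's `FP` bricks
(`PlumbingBricks.lean`, `HashBricks.lean`, `BrickAlgebra.lean`) around one call of the given
algorithm (the pattern of `GoldreichLevinProgram.lean`):

* `YaoNB.distRun A qA` — **predictor to distinguisher** ("only if" direction, Goldreich 2001,
  p. 120: "On input `y`, the distinguisher invokes `A` … In case the prediction is correct, `D`
  outputs 1"). On `⟨1ⁿ, x⟩` with coins `c`: with `B = qA(2n + 2 + |x|) + 1`, read the index
  `i = |c| / B` and the coin count `κ = |c| mod B` off the coin length, run `A` on
  `⟨1ⁿ, x ↾ i⟩` with coins `c ↾ κ`, and accept iff its answer is the bit `x_{i+1}`.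
  (The tree's `RandAlg` has a coin budget depending on the input length only; the index to be
  tested and the number of coins of `A` at that index are transmitted through it.)
* `YaoNB.predRun D ℓ` — **distinguisher to predictor** ("opposite" direction, Goldreich 2001,
  p. 122, algorithm `A`, steps 2–3). On `⟨1ⁿ, y⟩` with coins `c`: compute `m = ℓ(n)` (this is
  where `ℓ` has to be polynomial-time computable in unary), pad `y` with the next `m − |y|`
  coins `u`, run `D` on `⟨1ⁿ, y u⟩` with the remaining coins, and output the first padding bit if
  `D` says `1`, its complement otherwise.

Main results: `distRun_polyTime`, `predRun_polyTime` (polynomial time on `⟨input, coins⟩` for a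
PPT `A`, resp. a PPT `D` and a unary polynomial-time `ℓ`), packaged as `isPPT_distAlg`,
`isPPT_predAlg` for any polynomially bounded coin budget.

The last section collects the *data* of the probability analysis (`YaoNextBitProbability.lean`,
`PseudorandomnessProofs.lean`): the coin-space equivalences `splitVec` (prefix/suffix),
`pivotEquiv` (prefix, pivot bit, suffix), `headEquiv` (first bit, rest), the per-position success
probability `succProb A n X i = Pr[A(1ⁿ, x ↾ i) = x_{i+1}]` of a predictor, and the hybrid
acceptance probabilities `hyb D n κ x i e = Pr[D(1ⁿ, (x ↾ i) u) = 1]` (`u` uniform of length `e`)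
of a distinguisher — Goldreich's hybrids `H^i_n`, conditioned on `x`.

## References

* A. C. Yao, *Theory and applications of trapdoor functions*, FOCS 1982, pp. 80–91 (§4).
* O. Goldreich, *Foundations of Cryptography I: Basic Tools*, CUP 2001, §3.3.5, Thm. 3.3.7
  (proof, pp. 119–123 of the 2004 printing).
* S. Arora, B. Barak, *Computational Complexity: A Modern Approach*, CUP 2009, Thm. 9.11.
-/

namespace Literature.Computability.Cryptography

open _root_.Computability Polynomial Complexity Complexity.Brick Complexity.Plumb Complexity.OracleCompose
  Complexity.HashBricks

namespace YaoNB

/-! ### Small list facts -/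

/-- Length of a pair with a unary first component: `|⟨1ⁿ, x⟩| = 2n + 2 + |x|`
(`length_boolPair` with Mathlib's `unary_decode_encode_nat`). [folklore] -/
theorem length_boolPair_unaryEncodeNat (n : ℕ) (x : List Bool) :
    (boolPair (unaryEncodeNat n) x).length = 2 * n + 2 + x.length := by
  rw [length_boolPair, show (unaryEncodeNat n).length = n from unary_decode_encode_nat n]

/-- `!(b xor b') = (b == b')`. [folklore] -/
theorem not_xor_eq_beq (b b' : Bool) : (!(Bool.xor b b')) = (b == b') := by
  cases b <;> cases b' <;> rfl

/-! ### Calling a given randomized algorithm inside an `FP` pipeline -/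

/-- A Boolean-valued randomized algorithm as a string function `⟨w, r⟩ ↦ [A(w; r)]`. [folklore] -/
def algStr (A : RandAlg (List Bool) Bool) : List Bool → List Bool :=
  (fun p : List Bool × List Bool => encodeBool (A.run p.1 p.2)) ∘ boolUnpair

/-- Value of `algStr` on a pair. [folklore] -/
@[simp] theorem algStr_boolPair (A : RandAlg (List Bool) Bool) (w r : List Bool) :
    algStr A (boolPair w r) = [A.run w r] := by
  simp only [algStr, Function.comp_apply, boolUnpair_boolPair]
  cases A.run w r <;> rfl

/-- `algStr A` is one-bit. [folklore] -/
theorem algStr_eq (A : RandAlg (List Bool) Bool) (z : List Bool) :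
    algStr A z = [A.run (boolUnpair z).1 (boolUnpair z).2] := by
  simp only [algStr, Function.comp_apply]
  cases A.run (boolUnpair z).1 (boolUnpair z).2 <;> rfl

/-- For a PPT `A`, `algStr A ∈ FP` (the machine of `A` after the pair decoder). [folklore] -/
theorem algStr_mem_FP {A : RandAlg (List Bool) Bool} (hA : IsPPT A encodeBool) : algStr A ∈ FP := by
  have h1 : PolyTimeComputable (fun p : List Bool × List Bool => boolPair p.1 p.2) encodeBool
      (fun p : List Bool × List Bool => A.run p.1 p.2) := by
    obtain ⟨p, M, hM⟩ := hA.1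
    exact ⟨p, M, fun a => hM a⟩
  exact PolyTimeComputable.comp_holds h1 polyTimeComputable_boolUnpair

/-- **`w ↦ 1^{ℓ |w|}` is in `FP`** for `ℓ` polynomial-time computable in unary (the length map
`onesFn` followed by the machine of `ℓ`). [Arora–Barak 2009, §1.3] [folklore] -/
theorem ellFn_mem_FP {ℓ : ℕ → ℕ} (hℓ : PolyTimeComputable unaryEncodeNat unaryEncodeNat ℓ) :
    (fun w : List Bool => unaryEncodeNat (ℓ w.length)) ∈ FP := by
  have h1 : PolyTimeComputable (id : List Bool → List Bool) unaryEncodeNat (List.length : List Bool → ℕ) := by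
    obtain ⟨p, M, hM⟩ := onesFn_mem_FP
    exact ⟨p, M, fun w => hM w⟩
  obtain ⟨p, M, hM⟩ := PolyTimeComputable.comp_holds hℓ h1
  exact ⟨p, M, fun w => hM w⟩

/-! ### Direction "only if": the distinguisher built from a next-bit predictor -/

section Dist

variable (A : RandAlg (List Bool) Bool) (qA : Polynomial ℕ)

/-- **The run function of the distinguisher `D_A`** on `⟨a, x⟩` (`n = |a|`) with coins `c`:
`B = qA(2n+2+|x|) + 1`, `i = |c| / B`, `κ = |c| mod B`; accept iff
`A(⟨1ⁿ, x ↾ i⟩; c ↾ κ) = x_{i+1}` (`x_{i+1}` is `x.getD i false`, `0`-indexed).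
[Goldreich 2001, Thm. 3.3.7, proof of the "only-if" direction]
[cite: Goldreich2001, Thm. 3.3.7 (proof, only-if direction)] -/
def distRun (inp c : List Bool) : Bool :=
  A.run (boolPair (unaryEncodeNat (boolUnpair inp).1.length)
      ((boolUnpair inp).2.take (c.length / (qA.eval (2 * (boolUnpair inp).1.length + 2 + (boolUnpair inp).2.length) + 1))))
    (c.take (c.length % (qA.eval (2 * (boolUnpair inp).1.length + 2 + (boolUnpair inp).2.length) + 1))) ==
  (boolUnpair inp).2.getD (c.length / (qA.eval (2 * (boolUnpair inp).1.length + 2 + (boolUnpair inp).2.length) + 1)) false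

/-- `D_A` as a randomized algorithm with coin budget `cl`. [folklore] -/
def distAlg (cl : ℕ → ℕ) : RandAlg (List Bool) Bool where
  run := distRun A qA
  coinLen := cl

/-- `1ⁿ` (from `z = ⟨⟨a, x⟩, c⟩`, `n = |a|`). [folklore] -/
def uN : List Bool → List Bool := onesFn ∘ fstF ∘ fstF
/-- `x`. [folklore] -/
def xF : List Bool → List Bool := sndF ∘ fstF
/-- `1^{2n + 2 + |x|}`. [folklore] -/
noncomputable def LU : List Bool → List Bool :=
  concatFn ∘ fanoutFn (List.cons true ∘ List.cons true ∘ concatFn ∘ fanoutFn uN uN) (onesFn ∘ xF)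
/-- `1^B`, `B = qA(2n + 2 + |x|) + 1`. [folklore] -/
noncomputable def BU : List Bool → List Bool := List.cons true ∘ polyFn qA ∘ LU
/-- `⟨1^{|c| / B}, 1^{|c| mod B}⟩`. [folklore] -/
noncomputable def dmF : List Bool → List Bool := divModFn ∘ fanoutFn (BU qA) (onesFn ∘ sndF)
/-- `1^i`. [folklore] -/
noncomputable def iU : List Bool → List Bool := fstF ∘ dmF qA
/-- `1^κ`. [folklore] -/
noncomputable def kU : List Bool → List Bool := sndF ∘ dmF qA
/-- `A`'s coins `c ↾ κ`. [folklore] -/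
noncomputable def rF : List Bool → List Bool := takeFn ∘ fanoutFn (kU qA) sndF
/-- The prefix `x ↾ i`. [folklore] -/
noncomputable def yF : List Bool → List Bool := takeFn ∘ fanoutFn (iU qA) xF
/-- The bit `[x_{i+1}]`. [folklore] -/
noncomputable def bitF : List Bool → List Bool := headBitFn ∘ dropFn ∘ fanoutFn (iU qA) xF
/-- `A`'s answer `[A(⟨1ⁿ, x ↾ i⟩; c ↾ κ)]`. [folklore] -/
noncomputable def aOutF : List Bool → List Bool := algStr A ∘ fanoutFn (fanoutFn uN (yF qA)) (rF qA)
/-- **The distinguisher as a string function on `⟨inp, coins⟩`.** [folklore] -/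
noncomputable def distF : List Bool → List Bool := notFn (xorFn (aOutF A qA) (bitF qA))

variable {A qA}

section Values

variable (inp c : List Bool)

/-- `n`. [folklore] -/
theorem uN_apply : uN (boolPair inp c) = ones (boolUnpair inp).1.length := by
  simp [uN, fstF, onesFn, OracleCompose.unaryEncodeNat_eq_replicate]
/-- `x`. [folklore] -/
theorem xF_apply : xF (boolPair inp c) = (boolUnpair inp).2 := by simp [xF, fstF, sndF]
/-- `1^{2n+2+|x|}`. [folklore] -/
theorem LU_apply : LU (boolPair inp c) = ones (2 * (boolUnpair inp).1.length + 2 + (boolUnpair inp).2.length) := by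
  simp only [LU, Function.comp_apply, fanoutFn_apply, uN_apply, xF_apply, concatFn_boolPair, onesFn,
    OracleCompose.unaryEncodeNat_eq_replicate, List.cons_append]
  rw [Com.ones_append, Com.ones_append, ← Com.ones_succ, ← Com.ones_succ]
  congr 1; omega
/-- `1^B`. [folklore] -/
theorem BU_apply : BU qA (boolPair inp c) = ones (qA.eval (2 * (boolUnpair inp).1.length + 2 + (boolUnpair inp).2.length) + 1) := by
  simp only [BU, Function.comp_apply, LU_apply, polyFn_apply, List.length_replicate, Com.ones_succ]
/-- `⟨1^i, 1^κ⟩`. [folklore] -/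
theorem dmF_apply : dmF qA (boolPair inp c) =
    boolPair (ones (c.length / (qA.eval (2 * (boolUnpair inp).1.length + 2 + (boolUnpair inp).2.length) + 1)))
      (ones (c.length % (qA.eval (2 * (boolUnpair inp).1.length + 2 + (boolUnpair inp).2.length) + 1))) := by
  simp only [dmF, Function.comp_apply, fanoutFn_apply, BU_apply, sndF_boolPair, onesFn, OracleCompose.unaryEncodeNat_eq_replicate,
    divModFn_boolPair]
/-- `1^i`. [folklore] -/
theorem iU_apply : iU qA (boolPair inp c) =
    ones (c.length / (qA.eval (2 * (boolUnpair inp).1.length + 2 + (boolUnpair inp).2.length) + 1)) := by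
  simp only [iU, Function.comp_apply, dmF_apply, fstF_boolPair]
/-- `1^κ`. [folklore] -/
theorem kU_apply : kU qA (boolPair inp c) =
    ones (c.length % (qA.eval (2 * (boolUnpair inp).1.length + 2 + (boolUnpair inp).2.length) + 1)) := by
  simp only [kU, Function.comp_apply, dmF_apply, sndF_boolPair]
/-- `c ↾ κ`. [folklore] -/
theorem rF_apply : rF qA (boolPair inp c) =
    c.take (c.length % (qA.eval (2 * (boolUnpair inp).1.length + 2 + (boolUnpair inp).2.length) + 1)) := by
  simp only [rF, Function.comp_apply, fanoutFn_apply, kU_apply, sndF_boolPair, takeFn_boolPair, List.length_replicate]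
/-- `x ↾ i`. [folklore] -/
theorem yF_apply : yF qA (boolPair inp c) =
    (boolUnpair inp).2.take (c.length / (qA.eval (2 * (boolUnpair inp).1.length + 2 + (boolUnpair inp).2.length) + 1)) := by
  simp only [yF, Function.comp_apply, fanoutFn_apply, iU_apply, xF_apply, takeFn_boolPair, List.length_replicate]
/-- `[x_{i+1}]`. [folklore] -/
theorem bitF_apply : bitF qA (boolPair inp c) =
    [(boolUnpair inp).2.getD (c.length / (qA.eval (2 * (boolUnpair inp).1.length + 2 + (boolUnpair inp).2.length) + 1)) false] := by
  simp only [bitF, Function.comp_apply, fanoutFn_apply, iU_apply, xF_apply, dropFn_boolPair, List.length_replicate,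
    headBitFn_apply, List.headD_eq_head?_getD, List.head?_drop, List.getD_eq_getElem?_getD]
/-- `A`'s answer. [folklore] -/
theorem aOutF_apply : aOutF A qA (boolPair inp c) =
    [A.run (boolPair (unaryEncodeNat (boolUnpair inp).1.length)
      ((boolUnpair inp).2.take (c.length / (qA.eval (2 * (boolUnpair inp).1.length + 2 + (boolUnpair inp).2.length) + 1))))
      (c.take (c.length % (qA.eval (2 * (boolUnpair inp).1.length + 2 + (boolUnpair inp).2.length) + 1)))] := by
  simp only [aOutF, Function.comp_apply, fanoutFn_apply, uN_apply, yF_apply, rF_apply, algStr_boolPair,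
    OracleCompose.unaryEncodeNat_eq_replicate]

/-- **The string function computes the run function**: `distF ⟨inp, c⟩ = [distRun inp c]`. [folklore] -/
theorem distF_boolPair : distF A qA (boolPair inp c) = encodeBool (distRun A qA inp c) := by
  rw [distF, notFn_apply (xorFn_apply (aOutF_apply inp c) (bitF_apply inp c)), not_xor_eq_beq]
  rfl

end Values

/-- `distF ∈ FP` for a PPT `A`. [folklore] -/
theorem distF_mem_FP (hA : IsPPT A encodeBool) : distF A qA ∈ FP := by
  have huN : uN ∈ FP := comp_mem_FP onesFn_mem_FP (comp_mem_FP fstF_mem_FP fstF_mem_FP)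
  have hx : xF ∈ FP := comp_mem_FP sndF_mem_FP fstF_mem_FP
  have hL : LU ∈ FP := comp_mem_FP concatFn_mem_FP (fanoutFn_mem_FP
    (comp_mem_FP (cons_mem_FP true) (comp_mem_FP (cons_mem_FP true) (comp_mem_FP concatFn_mem_FP (fanoutFn_mem_FP huN huN))))
    (comp_mem_FP onesFn_mem_FP hx))
  have hB : BU qA ∈ FP := comp_mem_FP (cons_mem_FP true) (comp_mem_FP (polyFn_mem_FP qA) hL)
  have hdm : dmF qA ∈ FP := comp_mem_FP divModFn_mem_FP (fanoutFn_mem_FP hB (comp_mem_FP onesFn_mem_FP sndF_mem_FP))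
  have hi : iU qA ∈ FP := comp_mem_FP fstF_mem_FP hdm
  have hk : kU qA ∈ FP := comp_mem_FP sndF_mem_FP hdm
  have hr : rF qA ∈ FP := comp_mem_FP takeFn_mem_FP (fanoutFn_mem_FP hk sndF_mem_FP)
  have hy : yF qA ∈ FP := comp_mem_FP takeFn_mem_FP (fanoutFn_mem_FP hi hx)
  have hbit : bitF qA ∈ FP := comp_mem_FP headBitFn_mem_FP (comp_mem_FP dropFn_mem_FP (fanoutFn_mem_FP hi hx))
  have ha : aOutF A qA ∈ FP := comp_mem_FP (algStr_mem_FP hA) (fanoutFn_mem_FP (fanoutFn_mem_FP huN hy) hr)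
  exact notFn_mem_FP (xorFn_mem_FP ha hbit)

/-- **The distinguisher runs in polynomial time** on the pair presentation of (input, coins).
[Goldreich 2001, Thm. 3.3.7 (proof, only-if direction)] [cite: Goldreich2001, Thm. 3.3.7 (proof, only-if direction)] -/
theorem distRun_polyTime (hA : IsPPT A encodeBool) (qA : Polynomial ℕ) :
    PolyTimeComputable (fun p : List Bool × List Bool => boolPair p.1 p.2) encodeBool
      (Function.uncurry (distRun A qA)) := by
  obtain ⟨p, M, hM⟩ := distF_mem_FP (qA := qA) hA
  refine ⟨p, M, fun q => ?_⟩
  have h := hM (boolPair q.1 q.2)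
  rw [id, distF_boolPair] at h
  exact h

/-- **`D_A` is PPT** for a PPT `A` and any polynomially bounded coin budget.
[cite: Goldreich2001, Thm. 3.3.7 (proof, only-if direction)] -/
theorem isPPT_distAlg (hA : IsPPT A encodeBool) (qA : Polynomial ℕ) {cl : ℕ → ℕ}
    (hcl : ∃ p : Polynomial ℕ, ∀ n, cl n ≤ p.eval n) : IsPPT (distAlg A qA cl) encodeBool :=
  ⟨distRun_polyTime hA qA, hcl⟩

end Dist

/-! ### Direction "if": the next-bit predictor built from a distinguisher -/

section Pred

variable (D : RandAlg (List Bool) Bool) (ℓ : ℕ → ℕ)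

/-- **The run function of the predictor `A_D`** on `⟨a, y⟩` (`n = |a|`, `i = |y|`) with coins
`c`: `m = ℓ(n)`, `u = c ↾ (m - i)`, `r = c ⇂ (m - i)`; output `u₁` if `D(⟨1ⁿ, y u⟩; r) = 1` and
`¬ u₁` otherwise. [Goldreich 2001, Thm. 3.3.7, proof of the "opposite" direction, algorithm `A`]
[cite: Goldreich2001, Thm. 3.3.7 (proof, opposite direction, algorithm A)] -/
def predRun (inp c : List Bool) : Bool :=
  if D.run (boolPair (unaryEncodeNat (boolUnpair inp).1.length)
      ((boolUnpair inp).2 ++ c.take (ℓ (boolUnpair inp).1.length - (boolUnpair inp).2.length)))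
      (c.drop (ℓ (boolUnpair inp).1.length - (boolUnpair inp).2.length))
  then (c.take (ℓ (boolUnpair inp).1.length - (boolUnpair inp).2.length)).headD false
  else !(c.take (ℓ (boolUnpair inp).1.length - (boolUnpair inp).2.length)).headD false

/-- `A_D` as a randomized algorithm with coin budget `cl`. [folklore] -/
def predAlg (cl : ℕ → ℕ) : RandAlg (List Bool) Bool where
  run := predRun D ℓ
  coinLen := cl

/-- `1^{ℓ n}`. [folklore] -/
def mU : List Bool → List Bool := (fun w : List Bool => unaryEncodeNat (ℓ w.length)) ∘ uN
/-- `1^{m - |y|}`. [folklore] -/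
noncomputable def padU : List Bool → List Bool := dropFn ∘ fanoutFn (onesFn ∘ xF) (mU ℓ)
/-- The pad `u = c ↾ (m - |y|)`. [folklore] -/
noncomputable def uF : List Bool → List Bool := takeFn ∘ fanoutFn (padU ℓ) sndF
/-- `D`'s coins `r = c ⇂ (m - |y|)`. [folklore] -/
noncomputable def rDF : List Bool → List Bool := dropFn ∘ fanoutFn (padU ℓ) sndF
/-- `D`'s answer `[D(⟨1ⁿ, y u⟩; r)]`. [folklore] -/
noncomputable def dOutF : List Bool → List Bool :=
  algStr D ∘ fanoutFn (fanoutFn uN (concatFn ∘ fanoutFn xF (uF ℓ))) (rDF ℓ)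
/-- `[u₁]`. [folklore] -/
noncomputable def u0F : List Bool → List Bool := headBitFn ∘ uF ℓ
/-- **The predictor as a string function on `⟨inp, coins⟩`.** [folklore] -/
noncomputable def predF : List Bool → List Bool := notFn (xorFn (dOutF D ℓ) (u0F ℓ))

variable {D ℓ}

section Values

variable (inp c : List Bool)

/-- `1^{m}`. [folklore] -/
theorem mU_apply : mU ℓ (boolPair inp c) = ones (ℓ (boolUnpair inp).1.length) := by
  simp only [mU, Function.comp_apply, uN_apply, List.length_replicate, OracleCompose.unaryEncodeNat_eq_replicate]
/-- `1^{m - |y|}`. [folklore] -/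
theorem padU_apply : padU ℓ (boolPair inp c) = ones (ℓ (boolUnpair inp).1.length - (boolUnpair inp).2.length) := by
  simp only [padU, Function.comp_apply, fanoutFn_apply, onesFn, OracleCompose.unaryEncodeNat_eq_replicate, xF_apply, mU_apply,
    dropFn_boolPair, List.length_replicate, Com.drop_ones]
/-- `u`. [folklore] -/
theorem uF_apply : uF ℓ (boolPair inp c) = c.take (ℓ (boolUnpair inp).1.length - (boolUnpair inp).2.length) := by
  simp only [uF, Function.comp_apply, fanoutFn_apply, padU_apply, sndF_boolPair, takeFn_boolPair, List.length_replicate]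
/-- `r`. [folklore] -/
theorem rDF_apply : rDF ℓ (boolPair inp c) = c.drop (ℓ (boolUnpair inp).1.length - (boolUnpair inp).2.length) := by
  simp only [rDF, Function.comp_apply, fanoutFn_apply, padU_apply, sndF_boolPair, dropFn_boolPair, List.length_replicate]
/-- `D`'s answer. [folklore] -/
theorem dOutF_apply : dOutF D ℓ (boolPair inp c) =
    [D.run (boolPair (unaryEncodeNat (boolUnpair inp).1.length)
      ((boolUnpair inp).2 ++ c.take (ℓ (boolUnpair inp).1.length - (boolUnpair inp).2.length)))
      (c.drop (ℓ (boolUnpair inp).1.length - (boolUnpair inp).2.length))] := by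
  simp only [dOutF, Function.comp_apply, fanoutFn_apply, uN_apply, xF_apply, uF_apply, rDF_apply, concatFn_boolPair,
    algStr_boolPair, OracleCompose.unaryEncodeNat_eq_replicate]
/-- `[u₁]`. [folklore] -/
theorem u0F_apply : u0F ℓ (boolPair inp c) =
    [(c.take (ℓ (boolUnpair inp).1.length - (boolUnpair inp).2.length)).headD false] := by
  simp only [u0F, Function.comp_apply, uF_apply, headBitFn_apply]

/-- **The string function computes the run function**: `predF ⟨inp, c⟩ = [predRun inp c]`. [folklore] -/
theorem predF_boolPair : predF D ℓ (boolPair inp c) = encodeBool (predRun D ℓ inp c) := by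
  rw [predF, notFn_apply (xorFn_apply (dOutF_apply inp c) (u0F_apply inp c)), predRun]
  cases D.run (boolPair (unaryEncodeNat (boolUnpair inp).1.length)
      ((boolUnpair inp).2 ++ c.take (ℓ (boolUnpair inp).1.length - (boolUnpair inp).2.length)))
      (c.drop (ℓ (boolUnpair inp).1.length - (boolUnpair inp).2.length)) <;>
  cases (c.take (ℓ (boolUnpair inp).1.length - (boolUnpair inp).2.length)).headD false <;> rfl

end Values

/-- `predF ∈ FP` for a PPT `D` and a unary polynomial-time `ℓ`. [folklore] -/
theorem predF_mem_FP (hD : IsPPT D encodeBool) (hℓ : PolyTimeComputable unaryEncodeNat unaryEncodeNat ℓ) :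
    predF D ℓ ∈ FP := by
  have huN : uN ∈ FP := comp_mem_FP onesFn_mem_FP (comp_mem_FP fstF_mem_FP fstF_mem_FP)
  have hx : xF ∈ FP := comp_mem_FP sndF_mem_FP fstF_mem_FP
  have hm : mU ℓ ∈ FP := comp_mem_FP (ellFn_mem_FP hℓ) huN
  have hpad : padU ℓ ∈ FP := comp_mem_FP dropFn_mem_FP (fanoutFn_mem_FP (comp_mem_FP onesFn_mem_FP hx) hm)
  have hu : uF ℓ ∈ FP := comp_mem_FP takeFn_mem_FP (fanoutFn_mem_FP hpad sndF_mem_FP)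
  have hr : rDF ℓ ∈ FP := comp_mem_FP dropFn_mem_FP (fanoutFn_mem_FP hpad sndF_mem_FP)
  have hd : dOutF D ℓ ∈ FP := comp_mem_FP (algStr_mem_FP hD)
    (fanoutFn_mem_FP (fanoutFn_mem_FP huN (comp_mem_FP concatFn_mem_FP (fanoutFn_mem_FP hx hu))) hr)
  have hu0 : u0F ℓ ∈ FP := comp_mem_FP headBitFn_mem_FP hu
  exact notFn_mem_FP (xorFn_mem_FP hd hu0)

/-- **The predictor runs in polynomial time** on the pair presentation of (input, coins).
[Goldreich 2001, Thm. 3.3.7 (proof, opposite direction: "Because `A` is a probabilistic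
polynomial-time algorithm …")] [cite: Goldreich2001, Thm. 3.3.7 (proof, opposite direction)] -/
theorem predRun_polyTime (hD : IsPPT D encodeBool) (hℓ : PolyTimeComputable unaryEncodeNat unaryEncodeNat ℓ) :
    PolyTimeComputable (fun p : List Bool × List Bool => boolPair p.1 p.2) encodeBool
      (Function.uncurry (predRun D ℓ)) := by
  obtain ⟨p, M, hM⟩ := predF_mem_FP hD hℓ
  refine ⟨p, M, fun q => ?_⟩
  have h := hM (boolPair q.1 q.2)
  rw [id, predF_boolPair] at h
  exact h

/-- **`A_D` is PPT** for a PPT `D`, a unary polynomial-time `ℓ` and any polynomially bounded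
coin budget. [cite: Goldreich2001, Thm. 3.3.7 (proof, opposite direction)] -/
theorem isPPT_predAlg (hD : IsPPT D encodeBool) (hℓ : PolyTimeComputable unaryEncodeNat unaryEncodeNat ℓ)
    {cl : ℕ → ℕ} (hcl : ∃ p : Polynomial ℕ, ∀ n, cl n ≤ p.eval n) : IsPPT (predAlg D ℓ cl) encodeBool :=
  ⟨predRun_polyTime hD hℓ, hcl⟩

end Pred

/-! ### Coin spaces and the quantities of the probability analysis

The remaining declarations are the data used by the probability layer
(`YaoNextBitProbability.lean`): equivalences splitting a uniform coin string into independent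
uniform pieces, the per-position success probability of a predictor, and the hybrid acceptance
probabilities of a distinguisher. -/

noncomputable section

/-- A coin string of length `a + b` is a prefix of length `a` and a suffix of length `b`. [folklore] -/
def splitVec (a b : ℕ) : List.Vector Bool (a + b) ≃ List.Vector Bool a × List.Vector Bool b where
  toFun v := (⟨v.toList.take a, by rw [List.length_take, List.Vector.toList_length]; omega⟩,
    ⟨v.toList.drop a, by rw [List.length_drop, List.Vector.toList_length]; omega⟩)
  invFun p := ⟨p.1.toList ++ p.2.toList, by simp⟩
  left_inv v := List.Vector.eq _ _ (by simp)
  right_inv p := by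
    obtain ⟨u, r⟩ := p
    refine Prod.ext (List.Vector.eq _ _ ?_) (List.Vector.eq _ _ ?_)
    · simp [List.take_left' u.toList_length]
    · simp [List.drop_left' u.toList_length]

/-- The inverse of `splitVec` concatenates. [folklore] -/
@[simp] theorem splitVec_symm_apply_toList (a b : ℕ) (p : List.Vector Bool a × List.Vector Bool b) :
    ((splitVec a b).symm p).toList = p.1.toList ++ p.2.toList := rfl

/-- A coin string of length `i + (e + 1)` is a prefix of length `i`, a suffix of length `e`, and
the pivot bit at position `i` (paired with an unrelated coordinate `R`). [folklore] -/
def pivotEquiv (i e : ℕ) (R : Type*) :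
    List.Vector Bool (i + (e + 1)) × R ≃ ((List.Vector Bool i × List.Vector Bool e) × R) × Bool where
  toFun p := (((⟨p.1.toList.take i, by rw [List.length_take, List.Vector.toList_length]; omega⟩,
      ⟨p.1.toList.drop (i + 1), by rw [List.length_drop, List.Vector.toList_length]; omega⟩), p.2),
    p.1.toList.getD i false)
  invFun q := (⟨q.1.1.1.toList ++ q.2 :: q.1.1.2.toList, by
    simp only [List.length_append, List.length_cons, List.Vector.toList_length]⟩, q.1.2)
  left_inv p := by
    obtain ⟨v, r⟩ := p
    refine Prod.ext (List.Vector.eq _ _ ?_) rfl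
    have hi : i < v.toList.length := by rw [List.Vector.toList_length]; omega
    simp only [List.Vector.toList_mk]
    rw [List.getD_eq_getElem _ _ hi, List.cons_getElem_drop_succ, List.take_append_drop]
  right_inv q := by
    obtain ⟨⟨⟨a, w⟩, r⟩, b⟩ := q
    have ha : a.toList.length = i := a.toList_length
    refine Prod.ext (Prod.ext (Prod.ext (List.Vector.eq _ _ ?_) (List.Vector.eq _ _ ?_)) rfl) ?_
    · simp [List.take_left' ha]
    · simp only [List.Vector.toList_mk]
      rw [← List.singleton_append, ← List.append_assoc, List.drop_left']
      simp [ha]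
    · simp only [List.Vector.toList_mk, List.getD_eq_getElem?_getD]
      rw [List.getElem?_append_right (by omega), ha, Nat.sub_self]
      rfl

/-- The inverse of `pivotEquiv` reassembles the string. [folklore] -/
@[simp] theorem pivotEquiv_symm_apply_fst_toList (i e : ℕ) (R : Type*)
    (q : ((List.Vector Bool i × List.Vector Bool e) × R) × Bool) :
    ((pivotEquiv i e R).symm q).1.toList = q.1.1.1.toList ++ q.2 :: q.1.1.2.toList := rfl

/-- The inverse of `pivotEquiv` keeps the unrelated coordinate. [folklore] -/
@[simp] theorem pivotEquiv_symm_apply_snd (i e : ℕ) (R : Type*)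
    (q : ((List.Vector Bool i × List.Vector Bool e) × R) × Bool) :
    ((pivotEquiv i e R).symm q).2 = q.1.2 := rfl

/-- A coin string of length `e + 1` is its first bit and the rest (paired with an unrelated
coordinate `R`). [folklore] -/
def headEquiv (e : ℕ) (R : Type*) : List.Vector Bool (e + 1) × R ≃ (List.Vector Bool e × R) × Bool where
  toFun p := ((p.1.tail, p.2), p.1.head)
  invFun q := (q.2 ::ᵥ q.1.1, q.1.2)
  left_inv p := by obtain ⟨v, r⟩ := p; exact Prod.ext (List.Vector.cons_head_tail v) rfl
  right_inv q := by obtain ⟨⟨w, r⟩, b⟩ := q; simp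

/-- The inverse of `headEquiv` conses. [folklore] -/
@[simp] theorem headEquiv_symm_apply_fst_toList (e : ℕ) (R : Type*) (q : (List.Vector Bool e × R) × Bool) :
    ((headEquiv e R).symm q).1.toList = q.2 :: q.1.1.toList := by
  show (q.2 ::ᵥ q.1.1).toList = _
  exact List.Vector.toList_cons _ _

/-- The inverse of `headEquiv` keeps the unrelated coordinate. [folklore] -/
@[simp] theorem headEquiv_symm_apply_snd (e : ℕ) (R : Type*) (q : (List.Vector Bool e × R) × Bool) :
    ((headEquiv e R).symm q).2 = q.1.2 := rfl

/-- The distribution of the success indicator of the predictor `A` at position `i` (`0`-indexed):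
`x ← X`, run `A` on `(1ⁿ, x ↾ i)`, compare with `x_{i+1}`. [Arora–Barak 2009, Thm. 9.11] [folklore] -/
noncomputable def succPMF (A : RandAlg (List Bool) Bool) (n : ℕ) (X : PMF (List Bool)) (i : ℕ) : PMF Bool :=
  X.bind fun x => (A.outputPMF id (boolPair (unaryEncodeNat n) (x.take i))).map fun b => b == x.getD i false

/-- `succProb A n X i = Pr_{x ← X, r}[A(1ⁿ, x ↾ i; r) = x_{i+1}]`. [folklore] -/
noncomputable def succProb (A : RandAlg (List Bool) Bool) (n : ℕ) (X : PMF (List Bool)) (i : ℕ) : ℝ :=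
  (succPMF A n X i true).toReal

/-- The hybrid acceptance probability `Pr[D(1ⁿ, (x ↾ i) u; r) = 1]` with `e` fresh uniform
padding bits `u` (Goldreich's `Pr[D(H^i_n) = 1]` conditioned on `x`, for `e = m − i`).
[Goldreich 2001, proof of Thm. 3.3.7 (the hybrids `H^i_n`)] [folklore] -/
noncomputable def hyb (D : RandAlg (List Bool) Bool) (n κ : ℕ) (x : List Bool) (i e : ℕ) : ℝ :=
  uProb (fun p : List.Vector Bool e × List.Vector Bool κ =>
    D.run (boolPair (unaryEncodeNat n) (x.take i ++ p.1.toList)) p.2.toList)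

end

end YaoNB

end Literature.Computability.Cryptography
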